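import Summits.BirchSwinnertonDyer.BirchSwinnertonDyer.Theorems.ManinLocalTwoThreeEtaPowersOneTwentyEightC
import Summits.BirchSwinnertonDyer.BirchSwinnertonDyer.Theorems.ManinLocalTwoThreeEtaLimitsOneTwentyEightAC
import Summits.BirchSwinnertonDyer.BirchSwinnertonDyer.Theorems.ManinLocalTwoThreeEtaQuotientsOneTwentyEightCC
import HarnessLib

/-!
# Level 128 (class `96c`): (L1) `G_𝓧 + 48κΣc_jA_j = o(q³³)` at `i∞` — the analytic side of (I2a)

Cell bsd-f2-manin, route `ManinLocalTwoThree` (crux C2 `ManinOddAtFour` stmt-22967: `2² ∣ 128`; `128 = 2⁷`, `v₂(N) = 7` — the deepest `2`-adic cell of the charter's "no semistable partner" range; genus `9`, four newforms `128a–d`), prover seat p3 gen 24.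
Class `128c` (`128c1 = [0, -1, 0, 1, -1] : y² = x³ − x² + x − 1`, full rational `2`-torsion): `𝓧 = x` is the single `η`-quotient
`etaQuotient 128 (expFn [(2, 2), (4, -3), (8, 1), (16, -1), (32, 3), (64, -2)])` (`Γ₀(128)`-invariant), `𝓨 = η(expFn [(2, 2), (4, -5), (8, 3), (16, 1), (32, 1), (64, -2)])` satisfies `x′ = −2πiφ·2𝓨`, `𝓨² = x³ − x² + x − 1`, and
`φ₁₂₈c = -4B1 − 2B2 + 4B3 + 2B4 + B5 + 2B6` on an-g51's `η`-basis `B₁…B₅` of the new part (cell HOME/an/g51 `newform-coords-D.out`; the PINNING `⇑D.f = φ₁₂₈c` is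
NOT proved here).  THE E₂ ROAD (`EtaLogDerivativeForms`): `𝓧′ = (πi/12)G_𝓧𝓧`, `𝓨′ = (πi/12)G_𝓨𝓨`; `A_j = B_jη(r_𝓨)/𝓧`,
`C_j^{(2)} = B_j𝓧²/η(r_𝓨)`, `C_j^{(1)} = B_j𝓧/η(r_𝓨)`, `C_j^{(0)} = B_j/η(r_𝓨)` are INDIVIDUALLY HOLOMORPHIC weight-`2` `η`-quotients on `Γ₀(128)`
(Ligozat orders, `decide`), so (I2a), (I2b) are LINEAR relations in `M₂(Γ₀(128))` settled by Sturm (`μ = 192`, `⌊2·192/12⌋ + 1 = 33`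
coefficients).
Method: `QRemainder` calculus at depth `33`, each term reduced modulo `X³⁴` from `EtaPowersOneTwentyEightC` (witnesses by the seat script
`work/l128/gen96files.py`, re-verified by `ring`). Pure `q`-series analysis. Nothing here proves C2, Manin's conjecture or BSD; the other classes (`128b`, `128d` have no single η-quotient `y`) and the newform PINNING at `128` are separate; item 22967 stays OPEN. [cite: Zagier2008, §2.3]
-/

set_option autoImplicit false
-- lint-debt: the directory name repeats the summit name (sibling precedent `ManinLocalTwoThreeEtaLimitsOneHundredEight.lean`)
set_option linter.dupNamespace false

noncomputable section

open Complex Filter Topology Set Asymptotics Polynomial EisensteinSeries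
open UpperHalfPlane hiding I
open scoped Real Topology Manifold MatrixGroups ModularForm
open ModularForm CongruenceSubgroup
open Literature.NumberTheory.ModularForms
open Literature.NumberTheory.EllipticCurves Literature.NumberTheory.EllipticCurves.ModularForms

namespace Summit.BirchSwinnertonDyer.BirchSwinnertonDyer.Theorems.ManinLocalTwoThree.EtaLimitsOneTwentyEightC

open QRemainder EulerRemainders EulerRemaindersNinetySix EulerRemaindersOneTwentyEight EtaPowersNinetySixA EtaPowersNinetySixA2 EtaPowersNinetySixB EtaPowersOneTwentyEightA EtaPowersOneTwentyEightC LevelFortyFour EtaQuotientsOneTwentyEightC EtaQuotientsOneTwentyEightCB EtaLogDerivativeForms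
open EtaQuotientsOneTwentyEightA EtaQuotientsOneTwentyEightCC

/-- **(L1)₉₆c: `(G_𝓧 - 192…)/q³³ → 0` at `i∞`.** [cite: Zagier2008, §2.3] -/
theorem tendsto_L1 :
    Tendsto (fun τ : ℍ ↦ ((4 * E2 (sixMulPt 2 τ) - 12 * E2 (sixMulPt 4 τ) + 8 * E2 (sixMulPt 8 τ) - 16 * E2 (sixMulPt 16 τ) + 96 * E2 (sixMulPt 32 τ) - 128 * E2 (sixMulPt 64 τ))
        - 192 * etaQuotient 128 (expFn [(4, -2), (8, 3), (16, 3), (32, -3), (64, 1), (128, 2)]) τ - 96 * etaQuotient 128 (expFn [(4, -2), (8, 3), (16, 3), (32, -5), (64, 7), (128, -2)]) τ + 192 * etaQuotient 128 (expFn [(4, -2), (8, 3), (16, 2), (32, -1), (64, 2)]) τ + 96 * etaQuotient 128 (expFn [(4, -2), (8, 3), (16, 1), (32, 3), (64, -3), (128, 2)]) τ + 48 * etaQuotient 128 (expFn [(4, -2), (8, 3), (16, 1), (32, 1), (64, 3), (128, -2)]) τ + 96 * etaQuotient 128 (expFn [(4, -2), (8, 3), (32, 5), (64, -2)]) τ)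
      / Function.Periodic.qParam 1 (τ : ℂ) ^ 33) atImInfty (𝓝 0) := by
  have hGt := QRemainder.reduce (-48 - 96 * X ^ 2 + 96 * X ^ 4 - 192 * X ^ 6 + 48 * X ^ 8 + 288 * X ^ 10 - 96 * X ^ 12 + 576 * X ^ 14 + 336 * X ^ 16 - 864 * X ^ 20 + 384 * X ^ 22 - 288 * X ^ 24 - 480 * X ^ 26 + 768 * X ^ 28 - 2112 * X ^ 30 - 432 * X ^ 32)
    (2688 + 3072 * X ^ 2 + 192 * X ^ 4 + 384 * X ^ 6 - 1728 * X ^ 8 - 2304 * X ^ 10 + 2688 * X ^ 12 - 3840 * X ^ 14 + 6816 * X ^ 16 - 2304 * X ^ 18 + 12672 * X ^ 20 + 2304 * X ^ 22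
      + 9408 * X ^ 24 + 16128 * X ^ 28 + 8064 * X ^ 30)
    (by simp only [map_ofNat]; ring) (QRemainder.mul (QRemainder.sub (QRemainder.add (QRemainder.sub (QRemainder.add (QRemainder.sub (QRemainder.const_mul 4 LevelFortyFour.tendsto_E2_two_thirtyThree) (QRemainder.const_mul 12 LevelFortyFour.tendsto_E2_four_thirtyThree)) (QRemainder.const_mul 8 EulerRemaindersNinetySix.tendsto_E2_eight)) (QRemainder.const_mul 16 EulerRemaindersNinetySix.tendsto_E2_sixteen)) (QRemainder.const_mul 96 tendsto_E2_thirtyTwo)) (QRemainder.const_mul 128 tendsto_E2_sixtyFour)) EtaLimitsOneTwentyEightA.den_L1)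
  have hs1 := QRemainder.const_mul (-192 : ℂ) EtaLimitsOneTwentyEightA.L1_term1
  have hs2 := QRemainder.const_mul (-96 : ℂ) EtaLimitsOneTwentyEightA.L1_term2
  have hs3 := QRemainder.const_mul (192 : ℂ) EtaLimitsOneTwentyEightA.L1_term3
  have hs4 := QRemainder.const_mul (96 : ℂ) EtaLimitsOneTwentyEightA.L1_term4
  have hs5 := QRemainder.const_mul (48 : ℂ) EtaLimitsOneTwentyEightA.L1_term5
  have hs6 := QRemainder.const_mul (96 : ℂ) EtaLimitsOneTwentyEightA.L1_term6
  have hU := QRemainder.reduce 0 0 (by simp only [map_ofNat, map_neg]; ring)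
    (QRemainder.add (QRemainder.add (QRemainder.add (QRemainder.add (QRemainder.add (QRemainder.add hGt hs1) hs2) hs3) hs4) hs5) hs6)
  have hlim := (QRemainder.tendsto_div_pow 33 le_rfl hU).mul
    ((((((isIntUnitQExp_eulerFn (by norm_num : 0 < 4)).tendsto_one.pow 2).mul
      ((isIntUnitQExp_eulerFn (by norm_num : 0 < 32)).tendsto_one.pow 5)).mul
      ((isIntUnitQExp_eulerFn (by norm_num : 0 < 64)).tendsto_one.pow 3)).mul
      ((isIntUnitQExp_eulerFn (by norm_num : 0 < 128)).tendsto_one.pow 2)).inv₀ (by norm_num))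
  rw [zero_mul] at hlim
  refine hlim.congr fun τ ↦ ?_
  have hE4' := eulerFn_ne_zero (by norm_num : 0 < 4) τ
  have hE32' := eulerFn_ne_zero (by norm_num : 0 < 32) τ
  have hE64' := eulerFn_ne_zero (by norm_num : 0 < 64) τ
  have hE128' := eulerFn_ne_zero (by norm_num : 0 < 128) τ
  have hq := qParam_ne_zero τ
  rw [EtaQuotientsOneTwentyEightA.A1_eq, EtaQuotientsOneTwentyEightA.A2_eq, EtaQuotientsOneTwentyEightA.A3_eq, EtaQuotientsOneTwentyEightA.A4_eq, EtaQuotientsOneTwentyEightA.A5_eq, EtaQuotientsOneTwentyEightA.A6_eq]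
  field_simp
  ring

end Summit.BirchSwinnertonDyer.BirchSwinnertonDyer.Theorems.ManinLocalTwoThree.EtaLimitsOneTwentyEightC

end
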